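import Summits.Ventures.LatticeQCDFlow.Scaling.HomLadderTwoChannelLaw

/-!
HONEST FRAMING: exact (Metropolis-corrected) sampling algorithms for lattice gauge theory; figures
of merit are autocorrelation/cost numbers at stated couplings and volumes; no continuum-physics
claim.

# HotOnlyLadderMixingLaw — THE HOT-ONLY HOMOGENEOUS LADDER OF CHAPTER I FILE 14 (`w = 𝟙_{k=0}`, ARBITRARY COLD KERNELS, NEVER FIRED) IS `Θ(max{K³/t, K/(1−t)}·log K)` TWO-SIDED:
# **`(max{K(2K+1)²/(π²t), 2(K+1)/(3π(1−t))} − 1)·(½·log(K+1) − log(24√5)) ≤ t_mix(1/4) ≤ ⌈max{K(2K+1)²/t, π²(K+1)/(2√2(1−t))}·log(4√2K(K+1)(2K+1)/t)⌉`** (lean-2 GEN-47, ours)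

Venture-side (OURS).  Cell `lqcd-flow` (pub-lqcd), unit `pub-lqcd-lean-2-g47`, 2026-08-31.  Chapter AG, file 13 — the setting of chapter I file 14 §3 (`hotOnlyLadder_spectralGap_two_sided`: identical levels,
every update spent on the hot replica, `min{t/(6K²(K+1)), γ₀(1−t)/(6(K+1))} ≤ Gap ≤ 3t/(vK(K+1)(2K+1))`) with the exact hot sampler (`γ₀ = 1`): the mixing time carries the extra `log K` on
both sides.  With hot-only weights the cold kernels `M_k`, `k ≥ 1`, are never applied, so files 9 ∕ 12 apply after replacing them by idle ones inside the proof (the scheme depends on `M` only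
through `M_0`).  Hypothesis-equation `hP`; no definitions.

* `prodKernel_hotOnly_congr` (the hot-only product kernel depends on `M_0` only), `hotOnlyLadder_reduce`, `hotOnlyWeight_facts`, **`hotOnlyLadder_mixingTime_le`** (`K ≥ 1`, every `ε`), **`hotOnlyLadder_mixingTime_two_sided`** (`K ≥ 2`, swap-channel
  floor), **`hotOnlyLadder_mixingTime_two_sided_channels`** (`K ≥ 4`, both channels).

Reading (no numerics implied): chapter I file 14's `Θ(K³)` relaxation law for the hot-only ladder becomes `Θ(K³·log K)` for the mixing time from a cold start, both sides typed, for arbitrary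
(unused) cold kernels and every content law.  Literature grade (cell rule): OWN COROLLARY of AG9 ∕ AG12; nothing cited; no new bib keys.
-/

noncomputable section

open Finset Function Real
open Literature.Probability.MarkovChains

namespace Summit.Ventures.LatticeQCDFlow.Scaling

variable {S : Type*} [Fintype S] [DecidableEq S] {K : ℕ} {ν : S → ℝ} {M : Fin (K + 1) → S → S → ℝ} {t : ℝ}
  {P : (Fin (K + 1) → S) → (Fin (K + 1) → S) → ℝ}

omit [Fintype S] in
/-- The hot-only product kernel depends on the replica kernels only through `M_0`. [ours] -/
theorem prodKernel_hotOnly_congr {M M' : Fin (K + 1) → S → S → ℝ} (h0 : M' 0 = M 0) (x y : Fin (K + 1) → S) :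
    prodKernel (fun k : Fin (K + 1) => if k = 0 then (1 : ℝ) else 0) M x y = prodKernel (fun k : Fin (K + 1) => if k = 0 then (1 : ℝ) else 0) M' x y := by
  rw [prodKernel_hotOnly, prodKernel_hotOnly]
  unfold coordKernel
  rw [h0]

section HotOnly

/-- The idle replacement of the cold kernels: the hot-only scheme does not see them, so `P` is also the scheme with idle cold kernels. [ours] -/
theorem hotOnlyLadder_reduce (hP : ∀ x y, P x y = t * ptBareSwap (fun _ : Fin (K + 1) => ν) x y
      + (1 - t) * prodKernel (fun k : Fin (K + 1) => if k = 0 then (1 : ℝ) else 0) M x y) :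
    ∀ x y, P x y = t * ptBareSwap (fun _ : Fin (K + 1) => ν) x y
      + (1 - t) * prodKernel (fun k : Fin (K + 1) => if k = 0 then (1 : ℝ) else 0)
          (fun k : Fin (K + 1) => Fin.cases (M 0) (fun _ : Fin K => fun u v : S => if v = u then (1 : ℝ) else 0) k) x y := by
  intro x y
  rw [hP, prodKernel_hotOnly_congr (M := M) (M' := fun k : Fin (K + 1) => Fin.cases (M 0) (fun _ : Fin K => fun u v : S => if v = u then (1 : ℝ) else 0) k) rfl]

/-- Hot-only weights are a probability vector with positive hot weight. [ours] -/
theorem hotOnlyWeight_facts : (∀ k : Fin (K + 1), 0 ≤ (if k = 0 then (1 : ℝ) else 0)) ∧ (0 : ℝ) < (if (0 : Fin (K + 1)) = 0 then (1 : ℝ) else 0)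
    ∧ ∑ k : Fin (K + 1), (if k = 0 then (1 : ℝ) else 0) = 1 := by
  refine ⟨fun k => by split_ifs <;> norm_num, by rw [if_pos rfl]; norm_num, ?_⟩
  rw [Finset.sum_ite_eq' univ (0 : Fin (K + 1)), if_pos (mem_univ _)]

/-- **THE CEILING FOR THE HOT-ONLY HOMOGENEOUS LADDER** (`K ≥ 1`, `0 < t < 1`, one positive law `ν`, exact hot sampler, ARBITRARY cold kernels):
`t_mix(ε) ≤ ⌈max{K(2K+1)²/t, π²(K+1)/(2√2(1−t))}·log(√2K(K+1)(2K+1)/(tε))⌉`. [ours] -/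
theorem hotOnlyLadder_mixingTime_le (hK : 1 ≤ K) (ht0 : 0 < t) (ht1 : t < 1) (hν : ∀ v, 0 < ν v) (hν1 : ∑ v, ν v = 1) (hM0 : ∀ u v, M 0 u v = ν v)
    (hP : ∀ x y, P x y = t * ptBareSwap (fun _ : Fin (K + 1) => ν) x y + (1 - t) * prodKernel (fun k : Fin (K + 1) => if k = 0 then (1 : ℝ) else 0) M x y)
    {ε : ℝ} (hε : 0 < ε) :
    mixingTime P (tensorFun (fun _ : Fin (K + 1) => ν)) ε
      ≤ ⌈max ((K : ℝ) * (2 * K + 1) ^ 2 / t) (π ^ 2 * ((K : ℝ) + 1) / (2 * Real.sqrt 2 * ((1 - t) * 1)))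
          * Real.log (Real.sqrt 2 * K * ((K : ℝ) + 1) * (2 * K + 1) / (t * ε))⌉₊ := by
  obtain ⟨hw0, hw00, hw1⟩ := hotOnlyWeight_facts (K := K)
  have h := homLadder_mixingTime_le (M := fun k : Fin (K + 1) => Fin.cases (M 0) (fun _ : Fin K => fun u v : S => if v = u then (1 : ℝ) else 0) k)
    (w := fun k : Fin (K + 1) => if k = 0 then (1 : ℝ) else 0) hK ht0 ht1 hν hν1 (fun u v => by simp only [Fin.cases_zero]; exact hM0 u v)
    (fun i u v => by simp only [Fin.cases_succ]) hw0 hw00 hw1 (hotOnlyLadder_reduce hP) hε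
  simp only [if_true] at h
  exact h

/-- **THE HOT-ONLY HOMOGENEOUS LADDER IS `Θ((K³/t)·log K)`, BOTH SIDES** (`K ≥ 2`, `0 < t < 1`, some `ν(u) ≤ ½`, exact hot sampler, arbitrary cold kernels). [ours] -/
theorem hotOnlyLadder_mixingTime_two_sided (hK : 2 ≤ K) (ht0 : 0 < t) (ht1 : t < 1) (hν : ∀ v, 0 < ν v) (hν1 : ∑ v, ν v = 1) (hM0 : ∀ u v, M 0 u v = ν v)
    (hP : ∀ x y, P x y = t * ptBareSwap (fun _ : Fin (K + 1) => ν) x y + (1 - t) * prodKernel (fun k : Fin (K + 1) => if k = 0 then (1 : ℝ) else 0) M x y)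
    (u : S) (hu : ν u ≤ 1 / 2) :
    ((K : ℝ) * (2 * K + 1) ^ 2 / (π ^ 2 * t) - 1) * (Real.log ((K : ℝ) + 1) / 2 - Real.log (24 * Real.sqrt 5))
        ≤ (mixingTime P (tensorFun (fun _ : Fin (K + 1) => ν)) (1 / 4) : ℝ)
      ∧ mixingTime P (tensorFun (fun _ : Fin (K + 1) => ν)) (1 / 4)
        ≤ ⌈max ((K : ℝ) * (2 * K + 1) ^ 2 / t) (π ^ 2 * ((K : ℝ) + 1) / (2 * Real.sqrt 2 * ((1 - t) * 1)))
            * Real.log (Real.sqrt 2 * K * ((K : ℝ) + 1) * (2 * K + 1) / (t * (1 / 4)))⌉₊ := by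
  obtain ⟨hw0, hw00, hw1⟩ := hotOnlyWeight_facts (K := K)
  have h := homLadder_mixingTime_two_sided (M := fun k : Fin (K + 1) => Fin.cases (M 0) (fun _ : Fin K => fun u v : S => if v = u then (1 : ℝ) else 0) k)
    (w := fun k : Fin (K + 1) => if k = 0 then (1 : ℝ) else 0) hK ht0 ht1 hν hν1 (fun u v => by simp only [Fin.cases_zero]; exact hM0 u v)
    (fun i u v => by simp only [Fin.cases_succ]) hw0 hw00 hw1 (hotOnlyLadder_reduce hP) u hu
  simp only [if_true] at h
  exact h

/-- **BOTH CHANNELS** (`K ≥ 4`): `(max{K(2K+1)²/(π²t), 2(K+1)/(3π(1−t))} − 1)·(½·log(K+1) − log(24√5)) ≤ t_mix(1/4) ≤ ⌈max{K(2K+1)²/t, π²(K+1)/(2√2(1−t))}·log(4√2K(K+1)(2K+1)/t)⌉`.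
[ours] -/
theorem hotOnlyLadder_mixingTime_two_sided_channels (hK : 4 ≤ K) (ht0 : 0 < t) (ht1 : t < 1) (hν : ∀ v, 0 < ν v) (hν1 : ∑ v, ν v = 1) (hM0 : ∀ u v, M 0 u v = ν v)
    (hP : ∀ x y, P x y = t * ptBareSwap (fun _ : Fin (K + 1) => ν) x y + (1 - t) * prodKernel (fun k : Fin (K + 1) => if k = 0 then (1 : ℝ) else 0) M x y)
    (u : S) (hu : ν u ≤ 1 / 2) :
    (max ((K : ℝ) * (2 * K + 1) ^ 2 / (π ^ 2 * t)) (2 * ((K : ℝ) + 1) / (3 * π * ((1 - t) * 1))) - 1)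
          * (Real.log ((K : ℝ) + 1) / 2 - Real.log (24 * Real.sqrt 5))
        ≤ (mixingTime P (tensorFun (fun _ : Fin (K + 1) => ν)) (1 / 4) : ℝ)
      ∧ mixingTime P (tensorFun (fun _ : Fin (K + 1) => ν)) (1 / 4)
        ≤ ⌈max ((K : ℝ) * (2 * K + 1) ^ 2 / t) (π ^ 2 * ((K : ℝ) + 1) / (2 * Real.sqrt 2 * ((1 - t) * 1)))
            * Real.log (Real.sqrt 2 * K * ((K : ℝ) + 1) * (2 * K + 1) / (t * (1 / 4)))⌉₊ := by
  obtain ⟨hw0, hw00, hw1⟩ := hotOnlyWeight_facts (K := K)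
  have h := homLadder_mixingTime_two_sided_channels (M := fun k : Fin (K + 1) => Fin.cases (M 0) (fun _ : Fin K => fun u v : S => if v = u then (1 : ℝ) else 0) k)
    (w := fun k : Fin (K + 1) => if k = 0 then (1 : ℝ) else 0) hK hν hν1 (fun u v => by simp only [Fin.cases_zero]; exact hM0 u v)
    (fun i u v => by simp only [Fin.cases_succ]) hw0 hw00 hw1 ht0 ht1 (hotOnlyLadder_reduce hP) u hu
  simp only [if_true] at h
  exact h

end HotOnly

end Summit.Ventures.LatticeQCDFlow.Scaling

end
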